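import Mathlib
import Literature.MathematicalPhysics.QuantumFieldTheory.PottsGaugeWilsonLoopTopology
import HarnessLib

/-!
# Wilson loops = null-homology probabilities for EVERY `q ≥ 1`: Duncan–Schweinhart's
# Proposition 14 (CMP 2025, "codimension two") on the finite torus, with the `|H¹(P; ℤ_q)|`-weighted
# plaquette random-cluster model (Definition 6) — PROVED

Tenth file of the transcription of the Fortuin–Kasteleyn-type representation of `q`-state Potts
lattice gauge theory (companions: `PlaquetteRandomCluster` — setting, readings (R1)–(R3), (R7) and
the SCOPE caveat: `ℤ_q`/Potts gauge theory only, nothing here bears on the Yang–Mills mass gap or on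
`BalabanLadder.IR`; in the `ym` ladder only the conditional finite-`𝕋⁴` rung `BalabanLadder.UV` is
closed by any route —, `PottsGaugeEdwardsSokal` (Prop. 20/21 for any finite abelian coefficient
group, `weightGrp`), `PottsGaugeWilsonLoopTopology` (Theorem 5 for PRIME `q`)).

Source: P. Duncan, B. Schweinhart, *A sharp deconfinement transition for Potts lattice gauge theory
in codimension two*, Comm. Math. Phys. (2025), doi:10.1007/s00220-025-05338-x, arXiv:2308.07534
[DuncanSchweinhart2025codim2] (loci of the arXiv version, read in `lit read paper:arxiv-2308.07534`):
§2 **Definition 6** (the `i`-dimensional plaquette random-cluster model with coefficients in a finite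
abelian group `G`: `μ̃_{X,p,G,i}(P) = Z⁻¹ p^{|P|}(1-p)^{|X^{(i)}|-|P|} |H^{i-1}(P; G)|`), §3.1
**Proposition 12** (the coupling `κ(f,P) ∝ ∏_σ [(1-p) 1_{σ ∉ P} + p 1_{σ ∈ P, δf(σ)=0}]`,
`p = 1 - e^{-β}`, has first marginal `ν_{X,β,q,i-1}` and second marginal `μ̃_{X,p,ℤ_q,i}` for every
`q ∈ ℕ+1`), Corollary 13 (conditional laws), **Proposition 14** ("a generalization of Theorem 5 of
[duncan2022topological]"): for a finite cubical complex `X`, `0 < i < d - 1`, `q ∈ ℕ + 1` and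
`γ ∈ Z_{i-1}(X; ℤ_q)`, if `H_{i-2}(X; ℤ_q) = 0` then `𝔼_ν(W_γ) = μ̃(V_γ)` where `V_γ` is the event
`[γ] = 0 ∈ H_{i-1}(P; ℤ_q)`.

We type `i = 2` on the torus `X = 𝕋^d_L` (connected `1`-skeleton, so the hypothesis
`H̃₀(X; ℤ_q) = 0` holds) in the vocabulary of the companion files: the second marginal of Prop. 12
is `PlaquetteRC.sum_esWeight_eq_weightGrp` (already PROVED for any finite abelian `G`), `V_γ` is
`IsNullHomologousIn ω γ` with `ℤ_q`-coefficients (`γ = ∂c`, `c` a `ℤ_q` plaquette chain supported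
on `ω`, i.e. `[γ] = 0` in `H₁(P(ω); ℤ_q)`), and the `|H¹|`-weighted model is `weightGrp`.

## The one new algebraic input

For prime `q` the step "`γ` annihilates `Z¹(P(ω); 𝔽_q)` ⇒ `γ ∈ B₁(P(ω); 𝔽_q)`" is linear duality
over a field (`PottsGaugeWilsonLoopTopology`). For composite `q` the source argues through the
universal coefficient theorem `H^{i-1}(P; ℤ_q) ≅ Hom(H_{i-1}(P; ℤ_q), ℤ_q)` (Cor. (cor:UCTC)). We
prove the needed statement `Z¹(P(ω); ℤ_q)^⊥ = B₁(P(ω); ℤ_q)` (`forall_pairing_eq_zero_iff_zmod`)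
by PONTRYAGIN DUALITY for finite abelian groups (Mathlib's `AddChar.exists_apply_ne_zero`): a
chain `γ ∉ B₁` is separated from the subgroup `B₁` by a complex character of `C₁/B₁`; every
complex character of `C¹(𝕋; ℤ_q) = ℤ_q^{edges}` is `γ ↦ e^{2πi⟨θ,γ⟩/q}` for a cochain `θ`
(`exists_cochain_of_addChar`, from `stdAddChar` being primitive), and such a `θ` is automatically a
cocycle of `P(ω)` when the character kills `B₁(P(ω))`.

## Contents (everything PROVED; no named fact is introduced)

* `boundaryChains` — `B₁(P(ω); R)` as an `R`-submodule for any commutative ring `R`;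
* (private helpers `addChar_map_sum`, `exists_mulShift_eq` — every complex character of `ℤ_q` is
  `y ↦ e(ty)` —, `exists_cochain_of_addChar`) and `forall_pairing_eq_zero_iff_zmod` (**`Z¹(P(ω);ℤ_q)^⊥ = B₁(P(ω);ℤ_q)`**);
* the `|H¹(P; G)|`-weighted model as a probability: `partitionFnGrp`, `probGrp`, `eventProbGrp`
  (Definition 6, `i = 2`), `weightGrp_pos`, `partitionFnGrp_pos`, `sum_probGrp_eq_one`;
* `pottsPartitionFn_eq_grp` (`e^{-β|X²|} 𝒵_β = |B¹| Z̃_p`, Prop. 12 both marginals);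
* **`pottsExpect_wilsonLoopVar_eq_eventProbGrp`** — Proposition 14 on `𝕋^d_L` for every `q ≥ 1`:
  `𝔼_{ν_{β,q}}(W_γ) = μ̃_{1-e^{-β}, ℤ_q}(V_γ)` for every `ℤ_q` `1`-chain `γ` and every real `β`.
-/

open Finset

namespace Literature.MathematicalPhysics.QuantumFieldTheory

namespace PlaquetteRC

open LatticeForm

variable {d L : ℕ} [NeZero L]

/-! ### Boundaries with ring coefficients -/

section Boundaries

variable (R : Type*) [CommRing R]

/-- `B₁(P(ω); R) = {∂c : c an R-valued plaquette chain supported on ω}` as an `R`-submodule of the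
`1`-chains (for a field this is `PlaquetteRC.boundaries`). [cite: DuncanSchweinhart2025codim2, §A (B_{i-1}(P; G)) and Prop. 14 (V_γ: [γ] = 0 in H_{i-1}(P; ℤ_q))] -/
def boundaryChains (ω : Finset (Plaquette d L)) : Submodule R (Site d L → Fin d → R) where
  carrier := {γ | IsNullHomologousIn ω γ}
  add_mem' := by
    rintro a b ⟨c, hc, rfl⟩ ⟨c', hc', rfl⟩
    refine ⟨c + c', fun σ hσ => by rw [Pi.add_apply, hc σ hσ, hc' σ hσ, add_zero], ?_⟩
    funext x k
    simp only [bd₂, Pi.add_apply, add_mul, Finset.sum_add_distrib]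
  zero_mem' := by
    refine ⟨0, fun _ _ => rfl, ?_⟩
    funext x k
    simp only [bd₂, Pi.zero_apply, zero_mul, Finset.sum_const_zero]
  smul_mem' := by
    rintro r a ⟨c, hc, rfl⟩
    refine ⟨r • c, fun σ hσ => by rw [Pi.smul_apply, hc σ hσ, smul_zero], ?_⟩
    funext x k
    simp only [bd₂, Pi.smul_apply, smul_eq_mul, mul_assoc, Finset.mul_sum]

/-- Membership in `boundaryChains`. [cite: DuncanSchweinhart2025codim2, Prop. 14 (V_γ)] -/
theorem mem_boundaryChains {ω : Finset (Plaquette d L)} {γ : Site d L → Fin d → R} :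
    γ ∈ boundaryChains R ω ↔ IsNullHomologousIn ω γ := Iff.rfl

/-- `∂𝟙_σ ∈ B₁(P(ω))` for an open plaquette `σ ∈ ω`. [cite: DuncanSchweinhart2025codim2, Prop. 14 (proof: γ = ∂(Σ a_σ σ))] -/
theorem bd₂_plaqInd_mem_boundaryChains [DecidableEq (Plaquette d L)] {ω : Finset (Plaquette d L)}
    {σ : Plaquette d L} (hσ : σ ∈ ω) : bd₂ (plaqInd (R := R) σ) ∈ boundaryChains R ω :=
  ⟨plaqInd σ, fun τ hτ => by simp [plaqInd, show τ ≠ σ from fun h => hτ (h ▸ hσ)], rfl⟩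

end Boundaries

/-! ### Complex characters of `ℤ_q` and of the cochain group `C¹(𝕋; ℤ_q)` -/

section Characters

variable {n : ℕ} [NeZero n]

/-- An additive character turns finite sums into products. [folklore] -/
private theorem addChar_map_sum {A M : Type*} [AddCommMonoid A] [CommMonoid M] (ψ : AddChar A M)
    {ι : Type*} (s : Finset ι) (f : ι → A) : ψ (∑ i ∈ s, f i) = ∏ i ∈ s, ψ (f i) := by
  classical
  induction s using Finset.induction_on with
  | empty => simp
  | insert a s ha ih => rw [Finset.sum_insert ha, Finset.prod_insert ha, AddChar.map_add_eq_mul, ih]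

/-- **Every complex character of `ℤ_n` is `y ↦ e^{2πi t y/n}` for a unique `t ∈ ℤ_n`**: the map
`t ↦ stdAddChar(t ·)` is injective (`stdAddChar` is primitive) between finite sets of the same
cardinality `n = |ℤ_n^∧|`, hence surjective. [folklore] -/
private theorem exists_mulShift_eq (χ : AddChar (ZMod n) ℂ) :
    ∃ t : ZMod n, ∀ y : ZMod n, ZMod.stdAddChar (t * y) = χ y := by
  classical
  have hinj : Function.Injective (ZMod.stdAddChar (N := n)).mulShift :=
    AddChar.to_mulShift_inj_of_isPrimitive (ZMod.isPrimitive_stdAddChar n)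
  have hbij : Function.Bijective (ZMod.stdAddChar (N := n)).mulShift := by
    rw [Fintype.bijective_iff_injective_and_card]
    exact ⟨hinj, (AddChar.card_eq (α := ZMod n)).symm⟩
  obtain ⟨t, ht⟩ := hbij.2 χ
  refine ⟨t, fun y => ?_⟩
  rw [← ht, AddChar.mulShift_apply]

/-- **Every complex character of `C¹(𝕋^d_L; ℤ_n) = ℤ_n^{edges}` is `γ ↦ e^{2πi ⟨θ, γ⟩/n}` for some
cochain `θ`** (apply `exists_mulShift_eq` edge by edge and expand `γ = Σ_e γ(e) 𝟙_e`).
[folklore] -/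
private theorem exists_cochain_of_addChar (χ : AddChar (Site d L → Fin d → ZMod n) ℂ) :
    ∃ θ : Site d L → Fin d → ZMod n, ∀ γ : Site d L → Fin d → ZMod n,
      χ γ = ZMod.stdAddChar (pairing θ γ) := by
  classical
  -- the restriction of `χ` to the line spanned by `𝟙_e`
  have hedge : ∀ (x : Site d L) (k : Fin d), ∃ t : ZMod n, ∀ y : ZMod n,
      ZMod.stdAddChar (t * y) = χ (y • edgeInd (R := ZMod n) x k) := by
    intro x k
    obtain ⟨t, ht⟩ := exists_mulShift_eq
      (χ.compAddMonoidHom (LinearMap.toSpanSingleton (ZMod n) (Site d L → Fin d → ZMod n)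
        (edgeInd (R := ZMod n) x k)).toAddMonoidHom)
    exact ⟨t, fun y => by rw [ht y]; rfl⟩
  choose θ hθ using hedge
  refine ⟨θ, fun γ => ?_⟩
  conv_lhs => rw [← sum_smul_edgeInd γ]
  rw [addChar_map_sum]
  simp_rw [addChar_map_sum, ← hθ]
  unfold pairing
  rw [addChar_map_sum]
  simp_rw [addChar_map_sum]

/-- **`Z¹(P(ω); ℤ_n)^⊥ = B₁(P(ω); ℤ_n)` for every `n ≥ 1`** (the universal-coefficient step of the
proof of Proposition 14, here via Pontryagin duality): a `ℤ_n` `1`-chain annihilated by every cocycle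
of `P(ω)` is the boundary of a `ℤ_n` plaquette chain supported on `ω`, and conversely. If `γ ∉ B₁`,
a complex character of the finite abelian group `C₁/B₁` separates `[γ]` from `0`
(`AddChar.exists_apply_ne_zero`); pulled back to `C₁` it is `e^{2πi⟨θ,·⟩/n}` for a cochain `θ`
(`exists_cochain_of_addChar`) which is flat on `ω` because the character kills `∂𝟙_σ ∈ B₁`,
`σ ∈ ω`, and `stdAddChar` is injective; then `θ(γ) ≠ 0`. [cite: DuncanSchweinhart2025codim2, Prop. 14 (proof: H^{i-1}(P;ℤ_q) ≅ Hom(H_{i-1}(P;ℤ_q), ℤ_q), "there exists an f ∈ Z^{i-1}(P;ℤ_q) so that f(γ) ≠ 0")] -/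
theorem forall_pairing_eq_zero_iff_zmod (ω : Finset (Plaquette d L))
    (γ : Site d L → Fin d → ZMod n) :
    (∀ θ : Site d L → Fin d → ZMod n, (∀ σ ∈ ω, res (td₁ θ) σ = 0) → pairing θ γ = 0) ↔
      IsNullHomologousIn ω γ := by
  classical
  refine ⟨fun h => ?_, fun hγ θ hθ =>
    pairing_eq_zero_of_isNullHomologousIn (R := ZMod n) (mem_flatCochains.mpr hθ) hγ⟩
  by_contra hγ
  set B : AddSubgroup (Site d L → Fin d → ZMod n) := (boundaryChains (ZMod n) ω).toAddSubgroup
    with hB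
  have hmemB : ∀ c, c ∈ B ↔ IsNullHomologousIn ω c := fun c => Iff.rfl
  -- `[γ] ≠ 0` in the finite abelian group `C₁/B₁`
  have hne : (QuotientAddGroup.mk γ : (Site d L → Fin d → ZMod n) ⧸ B) ≠ 0 := by
    intro h0
    exact hγ ((hmemB γ).mp ((QuotientAddGroup.eq_zero_iff γ).mp h0))
  obtain ⟨ψ, hψ⟩ := (AddChar.exists_apply_ne_zero
    (α := (Site d L → Fin d → ZMod n) ⧸ B)).mpr hne
  -- pull back to a character of `C₁` killing `B₁`, and represent it by a cochain `θ`
  set χ : AddChar (Site d L → Fin d → ZMod n) ℂ := ψ.compAddMonoidHom (QuotientAddGroup.mk' B)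
    with hχ
  have hχB : ∀ c, IsNullHomologousIn ω c → χ c = 1 := by
    intro c hc
    rw [hχ, AddChar.compAddMonoidHom_apply, QuotientAddGroup.mk'_apply,
      (QuotientAddGroup.eq_zero_iff c).mpr ((hmemB c).mpr hc), AddChar.map_zero_eq_one]
  obtain ⟨θ, hθ⟩ := exists_cochain_of_addChar χ
  -- `θ` is a cocycle of `P(ω)`
  have hflat : ∀ σ ∈ ω, res (td₁ θ) σ = 0 := by
    intro σ hσ
    rw [res_td₁_eq_pairing_bd₂ θ σ]
    have h1 : (ZMod.stdAddChar (pairing θ (bd₂ (plaqInd (R := ZMod n) σ))) : ℂ) =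
        ZMod.stdAddChar (0 : ZMod n) := by
      rw [← hθ, AddChar.map_zero_eq_one]
      exact hχB _ (bd₂_plaqInd_mem_boundaryChains (ZMod n) hσ)
    exact ZMod.injective_stdAddChar h1
  -- contradiction: `χ γ = e(θ(γ)) = e(0) = 1`
  apply hψ
  have : χ γ = 1 := by
    rw [hθ γ, h θ hflat, AddChar.map_zero_eq_one]
  rw [hχ, AddChar.compAddMonoidHom_apply, QuotientAddGroup.mk'_apply] at this
  exact this

end Characters

/-! ### The `|H¹(P; G)|`-weighted model as a probability (Definition 6, `i = 2`) -/

section GroupModel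

variable (M : Type*) [AddCommGroup M] [Fintype M]

/-- The normalising constant `Z(X, p, G, 2) = Σ_ω p^{|ω|}(1-p)^{|ωᶜ|} |H¹(P(ω); G)|`.
[cite: DuncanSchweinhart2025codim2, Def. 6 eq. (4)] -/
noncomputable def partitionFnGrp (p : ℝ) : ℝ :=
  ∑ ω : Finset (Plaquette d L), weightGrp (d := d) (L := L) M p ω

/-- `μ̃_{X,p,G,2}(ω) = weightGrp(ω)/Z` (Definition 6 with `i = 2` on the torus; reading R7).
[cite: DuncanSchweinhart2025codim2, Def. 6 eq. (4)] -/
noncomputable def probGrp (p : ℝ) (ω : Finset (Plaquette d L)) : ℝ :=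
  weightGrp M p ω / partitionFnGrp (d := d) (L := L) M p

open Classical in
/-- `μ̃_{X,p,G,2}(E)` for an event `E`. [cite: DuncanSchweinhart2025codim2, Def. 6] -/
noncomputable def eventProbGrp (p : ℝ) (E : Set (Finset (Plaquette d L))) : ℝ :=
  ∑ ω : Finset (Plaquette d L), if ω ∈ E then probGrp M p ω else 0

/-- `|H¹(P(ω); G)| ≥ 1` (a finite group is non-empty). [cite: DuncanSchweinhart2025codim2, Def. 6] -/
theorem cohomologyCard_pos (ω : Finset (Plaquette d L)) : 0 < cohomologyCard (d := d) (L := L) ℤ M ω := by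
  classical
  unfold cohomologyCard
  haveI : Fintype (flatCochains (d := d) (L := L) ℤ M ω) := inferInstance
  haveI : Fintype (CohomologyOne (d := d) (L := L) ℤ M ω) := Submodule.Quotient.fintype _
  exact Nat.card_pos

/-- The group-weighted weights are positive for `p ∈ (0,1)`. [cite: DuncanSchweinhart2025codim2, Def. 6] -/
theorem weightGrp_pos {p : ℝ} (hp : p ∈ Set.Ioo (0 : ℝ) 1) (ω : Finset (Plaquette d L)) :
    0 < weightGrp (d := d) (L := L) M p ω := by
  unfold weightGrp
  have h1 : 0 < 1 - p := sub_pos.mpr hp.2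
  have h0 : 0 < p := hp.1
  have hc : (0 : ℝ) < (cohomologyCard (d := d) (L := L) ℤ M ω : ℝ) := by
    exact_mod_cast cohomologyCard_pos M ω
  positivity

omit [Fintype M] in
/-- The group-weighted weights are non-negative for `p ∈ [0,1]`. [cite: DuncanSchweinhart2025codim2, Def. 6] -/
theorem weightGrp_nonneg {p : ℝ} (hp : p ∈ Set.Icc (0 : ℝ) 1) (ω : Finset (Plaquette d L)) :
    0 ≤ weightGrp (d := d) (L := L) M p ω := by
  unfold weightGrp
  have h1 : 0 ≤ 1 - p := sub_nonneg.mpr hp.2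
  have h0 : 0 ≤ p := hp.1
  positivity

/-- `Z̃ > 0` for `p ∈ (0,1)`. [cite: DuncanSchweinhart2025codim2, Def. 6] -/
theorem partitionFnGrp_pos {p : ℝ} (hp : p ∈ Set.Ioo (0 : ℝ) 1) :
    0 < partitionFnGrp (d := d) (L := L) M p :=
  Finset.sum_pos (fun ω _ => weightGrp_pos M hp ω) Finset.univ_nonempty

/-- `μ̃` is a probability: `Σ_ω μ̃(ω) = 1`. [cite: DuncanSchweinhart2025codim2, Def. 6] -/
theorem sum_probGrp_eq_one {p : ℝ} (hp : p ∈ Set.Ioo (0 : ℝ) 1) :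
    ∑ ω : Finset (Plaquette d L), probGrp M p ω = 1 := by
  unfold probGrp
  rw [← Finset.sum_div, div_eq_one_iff_eq (partitionFnGrp_pos M hp).ne']
  rfl

end GroupModel

/-! ### Proposition 14 on the finite torus, every `q ≥ 1` -/

section WilsonLoopGeneralQ

variable (n : ℕ) [NeZero n]

/-- The number of `ℤ_n` cocycles of `P(ω)` is `|B¹(X; ℤ_n)| · |H¹(P(ω); ℤ_n)|` (Prop. 12, second
marginal, last two lines). [cite: DuncanSchweinhart2025codim2, Prop. 12 (proof: |Z^{i-1}(P;ℤ_q)| = |H^{i-1}(P;ℤ_q)| |B^{i-1}(P;ℤ_q)|)] -/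
theorem card_filter_flat_eq_grp (ω : Finset (Plaquette d L)) :
    ((Finset.univ.filter fun θ : Site d L → Fin d → ZMod n => ∀ σ ∈ ω, res (td₁ θ) σ = 0).card : ℝ) =
      (Nat.card (gradCochains (d := d) (L := L) ℤ (ZMod n)) : ℝ) *
        (cohomologyCard (d := d) (L := L) ℤ (ZMod n) ω : ℝ) := by
  rw [card_filter_flat_eq_natCard (ZMod n) ℤ, natCard_flatCochains_eq ℤ (ZMod n)]
  push_cast
  ring

/-- The Potts partition function through the coupling, group-weighted form (Prop. 12, both
marginals): `e^{-β|X²|} 𝒵_{β,ℤ_n} = |B¹(X;ℤ_n)| · Z̃_{1-e^{-β}, ℤ_n}`. [cite: DuncanSchweinhart2025codim2, Prop. 12] -/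
theorem pottsPartitionFn_eq_grp (β : ℝ) :
    Real.exp (-β * Fintype.card (Plaquette d L)) * pottsPartitionFn (d := d) (L := L) (ZMod n) β =
      (Nat.card (gradCochains (d := d) (L := L) ℤ (ZMod n)) : ℝ) *
        partitionFnGrp (d := d) (L := L) (ZMod n) (esParam β) := by
  classical
  unfold pottsPartitionFn partitionFnGrp
  rw [Finset.mul_sum]
  simp_rw [← sum_esWeight_eq_pottsWeight]
  rw [Finset.sum_comm, Finset.mul_sum]
  refine Finset.sum_congr rfl fun ω _ => ?_
  rw [sum_esWeight_eq_weightGrp]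

/-- **Proposition 14 (Duncan–Schweinhart, "codimension two") on the finite torus `𝕋^d_L`, PROVED
for every `q = n ≥ 1`.** For every real `β` and every `ℤ_n` `1`-chain `γ`, the `n`-state Potts
lattice gauge theory expectation of the Wilson loop variable equals the probability, under the
`|H¹(P; ℤ_n)|`-weighted plaquette random-cluster model with `p = 1 - e^{-β}` (Definition 6, `i = 2`),
that `γ` is a `ℤ_n`-boundary of the open plaquettes: `𝔼_{ν_{𝕋,β,n}}(W_γ) = μ̃_{𝕋,1-e^{-β},ℤ_n}(V_γ)`,
`V_γ = {[γ] = 0 ∈ H₁(P(ω); ℤ_n)}`. (Printed for `(i-1)`-cycles on a finite cubical complex `X` with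
`H_{i-2}(X;ℤ_q) = 0`; on the torus with `i = 2` that hypothesis holds, `W_γ` is gauge invariant only
for cycles, but the identity holds for every chain and every `β`. For prime `n` this is Theorem 5,
`pottsExpect_wilsonLoopVar_eq_eventProb`.) Proof as printed: condition on the plaquettes
(Prop. 12/Cor. 13), `𝔼(W_γ ∣ P) = 𝟙_{V_γ}` by the character sum over `Z¹(P(ω); ℤ_n)`
(`sum_char_pairing_eq`) and `Z¹(P(ω);ℤ_n)^⊥ = B₁(P(ω);ℤ_n)` (`forall_pairing_eq_zero_iff_zmod`).
[cite: DuncanSchweinhart2025codim2, Prop. 14] -/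
theorem pottsExpect_wilsonLoopVar_eq_eventProbGrp (β : ℝ) (γ : Site d L → Fin d → ZMod n) :
    pottsExpect (d := d) (L := L) (ZMod n) β (wilsonLoopVar n γ) =
      (eventProbGrp (d := d) (L := L) (ZMod n) (esParam β) {ω | IsNullHomologousIn ω γ} : ℂ) := by
  classical
  -- abbreviations: `NB = |B¹|`, `E = e^{-β|X²|}`
  set NB : ℝ := (Nat.card (gradCochains (d := d) (L := L) ℤ (ZMod n)) : ℝ) with hNB
  set E : ℝ := Real.exp (-β * Fintype.card (Plaquette d L)) with hE
  have hEpos : 0 < E := Real.exp_pos _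
  have hNBpos : 0 < NB := by
    rw [hNB]
    exact_mod_cast Nat.card_pos (α := gradCochains (d := d) (L := L) ℤ (ZMod n))
  have hZpos := pottsPartitionFn_pos (d := d) (L := L) (ZMod n) β
  -- Step 1: numerator `E Σ_f e^{-βH(f)} W_γ(f) = NB Σ_ω weightGrp(ω) 𝟙_{V_γ}(ω)`
  have hnum : (E : ℂ) * ∑ θ : Site d L → Fin d → ZMod n,
      (pottsWeight (ZMod n) β θ : ℂ) * wilsonLoopVar n γ θ =
      (NB : ℂ) * ∑ ω : Finset (Plaquette d L),
        if IsNullHomologousIn ω γ then (weightGrp (d := d) (L := L) (ZMod n) (esParam β) ω : ℂ)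
        else 0 := by
    rw [Finset.mul_sum]
    have h1 : ∀ θ : Site d L → Fin d → ZMod n, (E : ℂ) * ((pottsWeight (ZMod n) β θ : ℂ) *
        wilsonLoopVar n γ θ) = ∑ ω : Finset (Plaquette d L),
          (esWeight (ZMod n) β θ ω : ℂ) * wilsonLoopVar n γ θ := by
      intro θ
      rw [← Finset.sum_mul, ← mul_assoc]
      congr 1
      rw [hE]
      exact_mod_cast (sum_esWeight_eq_pottsWeight (ZMod n) β θ).symm
    simp_rw [h1]
    rw [Finset.sum_comm, Finset.mul_sum]
    refine Finset.sum_congr rfl fun ω _ => ?_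
    -- for fixed `ω`: `Σ_θ κ(θ,ω) W_γ(θ) = p^|ω| (1-p)^|ωᶜ| Σ_{θ ∈ Z¹(ω)} ψ(θ(γ))`
    have h2 : ∀ θ : Site d L → Fin d → ZMod n, (esWeight (ZMod n) β θ ω : ℂ) * wilsonLoopVar n γ θ =
        ((esParam β ^ ω.card * (1 - esParam β) ^ ωᶜ.card : ℝ) : ℂ) *
          (if (∀ σ ∈ ω, res (td₁ θ) σ = 0) then (ZMod.stdAddChar (pairing θ γ) : ℂ) else 0) := by
      intro θ
      rw [esWeight_eq_ite]
      by_cases hθ : ∀ σ ∈ ω, res (td₁ θ) σ = 0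
      · rw [if_pos hθ, if_pos hθ, wilsonLoopVar]
      · rw [if_neg hθ, if_neg hθ]
        simp
    simp_rw [h2]
    rw [← Finset.mul_sum, sum_char_pairing_eq]
    by_cases hV : IsNullHomologousIn ω γ
    · rw [if_pos ((forall_pairing_eq_zero_iff_zmod ω γ).mpr hV), if_pos hV]
      have hc : ((Finset.univ.filter fun θ : Site d L → Fin d → ZMod n =>
          ∀ σ ∈ ω, res (td₁ θ) σ = 0).card : ℂ) =
          (NB : ℂ) * (cohomologyCard (d := d) (L := L) ℤ (ZMod n) ω : ℂ) := by
        have := card_filter_flat_eq_grp n ω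
        rw [hNB]
        exact_mod_cast this
      rw [hc, weightGrp]
      push_cast
      ring
    · rw [if_neg (fun h => hV ((forall_pairing_eq_zero_iff_zmod ω γ).mp h)), if_neg hV]
      simp
  -- Step 2: denominator `E 𝒵 = NB Z̃`
  have hden : E * pottsPartitionFn (d := d) (L := L) (ZMod n) β =
      NB * partitionFnGrp (d := d) (L := L) (ZMod n) (esParam β) := pottsPartitionFn_eq_grp n β
  have hRCpos : 0 < partitionFnGrp (d := d) (L := L) (ZMod n) (esParam β) := by
    have h := mul_pos hEpos hZpos
    rw [hden] at h
    exact (mul_pos_iff_of_pos_left hNBpos).mp h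
  -- Step 3: assemble the two quotients
  set Sθ : ℂ := ∑ θ : Site d L → Fin d → ZMod n,
    (pottsWeight (ZMod n) β θ : ℂ) * wilsonLoopVar n γ θ with hSθ
  set Sω : ℂ := ∑ ω : Finset (Plaquette d L),
    (if IsNullHomologousIn ω γ then (weightGrp (d := d) (L := L) (ZMod n) (esParam β) ω : ℂ) else 0)
    with hSω
  have hZ0 : (pottsPartitionFn (d := d) (L := L) (ZMod n) β : ℂ) ≠ 0 := by exact_mod_cast hZpos.ne'
  have hRC0 : (partitionFnGrp (d := d) (L := L) (ZMod n) (esParam β) : ℂ) ≠ 0 := by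
    exact_mod_cast hRCpos.ne'
  have hL : pottsExpect (d := d) (L := L) (ZMod n) β (wilsonLoopVar n γ) =
      Sθ / (pottsPartitionFn (d := d) (L := L) (ZMod n) β : ℂ) := by
    unfold pottsExpect pottsProb
    rw [hSθ, Finset.sum_div]
    refine Finset.sum_congr rfl fun θ _ => ?_
    push_cast
    ring
  have hR : (eventProbGrp (d := d) (L := L) (ZMod n) (esParam β) {ω | IsNullHomologousIn ω γ} : ℂ) =
      Sω / (partitionFnGrp (d := d) (L := L) (ZMod n) (esParam β) : ℂ) := by
    unfold eventProbGrp probGrp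
    rw [Complex.ofReal_sum, hSω, Finset.sum_div]
    refine Finset.sum_congr rfl fun ω _ => ?_
    simp only [Set.mem_setOf_eq]
    split_ifs <;> simp [Complex.ofReal_div]
  have hdenC : (E : ℂ) * (pottsPartitionFn (d := d) (L := L) (ZMod n) β : ℂ) =
      (NB : ℂ) * (partitionFnGrp (d := d) (L := L) (ZMod n) (esParam β) : ℂ) := by
    exact_mod_cast hden
  have hE0 : (E : ℂ) ≠ 0 := by exact_mod_cast hEpos.ne'
  have hNB0 : (NB : ℂ) ≠ 0 := by exact_mod_cast hNBpos.ne'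
  rw [hL, hR, div_eq_div_iff hZ0 hRC0]
  have key : (E : ℂ) * (NB : ℂ) * (Sθ * (partitionFnGrp (d := d) (L := L) (ZMod n) (esParam β) : ℂ) -
      Sω * (pottsPartitionFn (d := d) (L := L) (ZMod n) β : ℂ)) = 0 := by
    linear_combination ((NB : ℂ) * (partitionFnGrp (d := d) (L := L) (ZMod n) (esParam β) : ℂ)) * hnum -
      ((NB : ℂ) * Sω) * hdenC
  have h0 := (mul_eq_zero.mp key).resolve_left (mul_ne_zero hE0 hNB0)
  exact sub_eq_zero.mp h0

end WilsonLoopGeneralQ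

end PlaquetteRC

end Literature.MathematicalPhysics.QuantumFieldTheory
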